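import Summits.CriticalPhenomena.PercolationContinuityZ3.Theorems.PercNearOneGluingNoHeavyQuantDepthOneRows
import Summits.CriticalPhenomena.PercolationContinuityZ3.Theorems.PercNearOneGluingNoHeavyQuantPhantomRelay
import Summits.CriticalPhenomena.PercolationContinuityZ3.Theorems.PercNearOneGluingNoHeavyQuantFlowUncross
import HarnessLib

/-!
# QUANT lane R8, depth-2 closure (D2) in the RELAY case: THE TILT ROWS — the top-layer `LawDec.TLC` rows `(M, i)` of
# (relay_g) ∗ μ at target `T + g` whose top pair `(i, M)` is NOT cheap, from mass, mean and top-affordability alone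

builds on p205010 (kernel theorem, internal audit signed; external expert review pending)

Support file (`--supports stmt-CriticalPhenomena-4575`), QUANT lane seat prim-quant-arm-2 (gen 39), rung R8 of
`run/shared/lean/prim/quant/LADDER.md`; lane pointer `run/shared/lean/prim/quant/FOR-PROVERS-D2-RELAY.md` §2 (a) / §3 (3) (census-2 g67:
"a tilt lemma for the regime-M rows; needs mean + TA of μ").  Theorems only, standard axioms, no sorries.

SETTING (q = 1 relay case of D2 / G₁).  `μ ≥ 0` on `{0..M}` of mass `1` and mean `T`, top-affordable at the floor `0 < y < 1` (`y·M ≤ T`),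
`u = y/(1−y)`; partner `{0: 1−g, 1: g}` with `y ≤ g ≤ 1`; product `ν = lconv M 1 μ {0:1−g, 1:g}` on `{0..M+1}`, target `T + g`.  Census-2 g67's
ONE-ROW LEMMA (`relayConv_tlcRow_of_tlc2` / `relayConv_tlcRowZero_of_tlc`) gives every product top-low-capacity row `(j, i)` (`LawDec.TLC`,
`…QuantDepthOneRows`) from ONE factor row — EXCEPT the rows of the top product layer `j = M` whose top pair `(i, M)` is not a cheap compatible mid
at `T + g` (there its `hcase` hypothesis fails: the factor has no layer `M`, and at layer `M − 1` the atom `M` is a factor giant collecting `1` while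
the pulled-back product row collects only `(1−g)·u·cap + g < 1`).  The census (DEPTH2-CLOSURE-G67 §3; ARM-REF g118) found all of them tilt-only.
THIS FILE proves it, with the EXPLICIT tilt `(1−g)·C′(a) + g·C′(a+1) ≤ (u/(T + g − 2i))·(T − a)` for every atom `a ≤ M` (`relay_tilt_pointwise`;
`C′` = coefficients of the product row `(M, i)` at `T + g`: `+u` on lows, `−u/usage` on compatible mids, `−1` on the giant `M + 1`); integrating
against `μ` (`sum_fun_mul_lconv_one`, lead g38) with `Σ μ = 1`, `Σ a·μ(a) = T` gives the row in functional form (`relayConv_tlcRowTop_functional`,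
the input of census-2's bridge `tlcRow_of_functional`).  ANY product low `i` is allowed (`2i < T + g`: the "new top low" `T ≤ 2i` and `i = 0`
included; for `i = 0` the top pair is never cheap under top-affordability, so the product row `(M, 0)` is always this lemma's).

WHY (arm-2 g39; exact exploration: 28 605 non-cheap top rows of the census grid, A = u/(T+g−2i) valid in all, worst margin 0).  Put
`c = T + g − 2i`, `ρ′(i,a) = c/(a − i)`.  NOT cheap means `y < ρ′(i, M)` (or `M` incompatible), so EVERY product mid is in the LINEAR regime of
`LawDec.pairGate` (`1/usage = (a − i)/c − 1`, `one_div_usage_linear`), where the relay identity `(1−g)((a−i)/c − 1) + g((a+1−i)/c − 1) = (a+i−T)/c`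
makes the charge on a mid `a > T` exactly `u(a + i − T)/c ≥ u(a − T)/c`; lows `a < i` cost `u ≤ (u/c)(T − a)` as `T − a ≥ c`; `a = i` costs
`≤ (1−g)u ≤ (u/c)(T − i)` (for `i = 0`, `T + g < 1`: exactly `uT/(T+g)`); the top atom collects `(1−g)u((M−i)/c − 1) + g ≥ (u/c)(M − T)` — for
`i ≥ 1` by non-cheapness (`y(M−i) < c`), for `i = 0` by top-affordability (`u(M−T) ≤ T`, `(1−g)u ≤ g`).  No factor row is used.
HONEST STATUS: one more row family of the relay case of D2 / G₁ (`LawDec.TLC2GateConvTLC`) is a theorem; D2, G₁, SGC and `Quant.FarTreeRow` (light)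
remain OPEN; nothing here is cited as a published result; the lane's RATE class log\* and honest sentence (`…/prim/quant/README.md`) are unchanged.

[this work]; one-row lemma / regime-M census: prim-quant-census-2 g67; `sum_fun_mul_lconv_one`: prim-quant-lead g38; usage / pairGate: prim-quant-stmt
g22 (this lane).  The gluing rows served [cite: KozmaNitzan2024, Conjecture 3 (p. 15)]; product measure [cite: Grimmett1999, §1.3 p. 10].
-/

noncomputable section

namespace Summit.CriticalPhenomena.PercolationContinuityZ3.Theorems

namespace Quant

open Finset

namespace LawDec

/-! ### The linear regime of the minimal gate -/

/-- in the linear regime `y ≤ ρ` the minimal gate IS `ρ`: `pairGate y τ l h = (τ − 2l)/(h − l)`. [this work] -/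
theorem pairGate_eq_rho_of_le (y τ : ℝ) (l h : ℕ) (hy0 : 0 ≤ y)
    (hρ : y ≤ (τ - 2 * (l : ℝ)) / ((h : ℝ) - l)) :
    pairGate y τ l h = (τ - 2 * (l : ℝ)) / ((h : ℝ) - l) := by
  unfold pairGate
  refine max_eq_left ?_
  nlinarith [mul_nonneg hy0 (sub_nonneg.2 hρ)]

/-- **`1/usage` below the layer in the linear regime**: `h ≤ j`, `0 < y ≤ ρ = (τ − 2l)/(h − l)` ⟹ `1/usage y τ j l h = (h − l)/(τ − 2l) − 1`. [this work] -/
theorem one_div_usage_linear (y τ : ℝ) (j l h : ℕ) (hy0 : 0 < y) (hh : h ≤ j)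
    (hρ : y ≤ (τ - 2 * (l : ℝ)) / ((h : ℝ) - l)) :
    1 / usage y τ j l h = ((h : ℝ) - l) / (τ - 2 * (l : ℝ)) - 1 := by
  have hnj : ¬ (j + 1 ≤ h) := by omega
  simp only [usage, gateOf, if_neg hnj]
  rw [pairGate_eq_rho_of_le y τ l h hy0.le hρ]
  have hρ0 : 0 < (τ - 2 * (l : ℝ)) / ((h : ℝ) - l) := lt_of_lt_of_le hy0 hρ
  rw [one_div_div, sub_div, div_self hρ0.ne', one_div_div]

/-- **not cheap ⟹ linear**: for a compatible pair below the layer (`h ≤ j`, `2l < τ < l + h`, `0 < y < 1`),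
`y/(1−y) < usage y τ j l h` forces `y < ρ = (τ − 2l)/(h − l)`. [this work] -/
theorem rho_gt_of_usage_gt (y τ : ℝ) (j l h : ℕ) (hy0 : 0 < y) (hy1 : y < 1) (hh : h ≤ j)
    (hlow : 2 * (l : ℝ) < τ) (hcomp : τ < (l : ℝ) + h) (hu : y / (1 - y) < usage y τ j l h) :
    y < (τ - 2 * (l : ℝ)) / ((h : ℝ) - l) := by
  have hnj : ¬ (j + 1 ≤ h) := by omega
  simp only [usage, gateOf, if_neg hnj] at hu
  have hG1 : pairGate y τ l h < 1 := pairGate_lt_one y τ l h hy0 hy1 hlow hcomp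
  have h1y : 0 < 1 - y := by linarith
  have hyG : y < pairGate y τ l h := by
    by_contra hle
    have hle' : pairGate y τ l h ≤ y := not_lt.1 hle
    have h1 : 0 < 1 - pairGate y τ l h := by linarith
    rw [div_lt_div_iff₀ h1y h1] at hu
    nlinarith
  by_contra hle
  have hle : (τ - 2 * (l : ℝ)) / ((h : ℝ) - l) ≤ y := not_lt.1 hle
  have : pairGate y τ l h ≤ y := by
    unfold pairGate
    refine max_le hle ?_
    nlinarith [mul_nonneg h1y.le (sub_nonneg.2 hle)]
  linarith

/-! ### The tilt certificate, pointwise -/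

/-- bookkeeping: `x·c ≤ u·t`, `0 < c` ⟹ `x ≤ (u/c)·t`. [this work] -/
theorem le_div_mul_of_mul_le {x u c t : ℝ} (hc : 0 < c) (h : x * c ≤ u * t) : x ≤ u / c * t := by
  rw [div_mul_eq_mul_div, le_div_iff₀ hc]; exact h

/-- **THE TILT, POINTWISE.**  `0 < y < 1`, `u = y/(1−y)`, `y ≤ g ≤ 1`, a product low `i ≤ M` (`2i < T + g`, `c = T + g − 2i`), top-affordability
`y·M ≤ T`, and the top pair `(i, M)` NOT cheap at `T + g` (`T + g < i + M → u < usage y (T+g) M i M`).  With `C′` the coefficient vector of the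
product top-low-capacity row `(M, i)` at `(y, T + g)` on `{0..M+1}`, for every atom `a ≤ M`:  `(1−g)·C′(a) + g·C′(a+1) ≤ (u/c)·(T − a)`. [this work] -/
theorem relay_tilt_pointwise (y T g u c : ℝ) (i M : ℕ) (Cp : ℕ → ℝ)
    (hy0 : 0 < y) (hy1 : y < 1) (hu : u = y / (1 - y)) (hyg : y ≤ g) (hg1 : g ≤ 1)
    (hiM : i ≤ M) (hlow : 2 * (i : ℝ) < T + g) (hc : c = T + g - 2 * (i : ℝ)) (hTA : y * (M : ℝ) ≤ T)
    (hnc : T + g < (i : ℝ) + M → u < usage y (T + g) M i M)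
    (hCp : ∀ h : ℕ, Cp h = u * (if h ≤ i then (1 : ℝ) else 0) - (if M + 1 ≤ h then (1 : ℝ) else 0)
      - u * (if h ≤ M ∧ T + g < (i : ℝ) + h then 1 / usage y (T + g) M i h else 0))
    (a : ℕ) (ha : a ≤ M) :
    (1 - g) * Cp a + g * Cp (a + 1) ≤ u / c * (T - a) := by
  have h1y : 0 < 1 - y := by linarith
  have hu0 : 0 < u := by rw [hu]; exact div_pos hy0 h1y
  have hg0 : 0 < g := lt_of_lt_of_le hy0 hyg
  have hc0 : 0 < c := by rw [hc]; linarith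
  have hi0 : (0 : ℝ) ≤ i := Nat.cast_nonneg i
  have hM0 : (0 : ℝ) ≤ M := Nat.cast_nonneg M
  have hT0 : 0 ≤ T := le_trans (mul_nonneg hy0.le hM0) hTA
  have hR0 : ∀ t : ℝ, 0 ≤ t → 0 ≤ u / c * t := fun t ht => mul_nonneg (div_nonneg hu0.le hc0.le) ht
  -- `(1−g)u ≤ g` (the relay is top-affordable: `g ≥ y`)
  have hgu : (1 - g) * u ≤ g := by
    rw [hu, mul_div_assoc', div_le_iff₀ h1y]; linarith
  -- the capacity of a compatible mid below the layer is nonnegative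
  have hinv0 : ∀ h : ℕ, h ≤ M → T + g < (i : ℝ) + h → 0 ≤ 1 / usage y (T + g) M i h := by
    intro h hhM hch
    have hih : i < h := by
      have : (i : ℝ) < h := by linarith
      exact_mod_cast this
    exact (one_div_pos.2 (usage_pos_of_compat y (T + g) M i h hy0 hy1 hlow hih (Or.inr hch))).le
  rcases Nat.lt_or_ge a i with hai | hia
  · ---- (A) a deep low: both copies price it, `e = u ≤ (u/c)(T − a)` since `T − a ≥ c`
    have ha' : (a : ℝ) + 1 ≤ i := by exact_mod_cast hai
    have e1 : Cp a = u := by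
      rw [hCp a, if_pos hai.le, if_neg (by omega), if_neg (fun h => by linarith [h.2])]; ring
    have e2 : Cp (a + 1) = u := by
      rw [hCp (a + 1), if_pos (by omega), if_neg (by omega), if_neg (fun h => by push_cast at h; linarith [h.2])]; ring
    rw [e1, e2]
    refine le_div_mul_of_mul_le hc0 ?_
    have hca : c ≤ T - a := by rw [hc]; linarith
    linarith [mul_le_mul_of_nonneg_left hca hu0.le]
  rcases hia.eq_or_lt with hia' | hia'
  · ---- (B) a = i, the top low of the product
    subst hia'
    have e1 : Cp i = u := by
      rw [hCp i, if_pos le_rfl, if_neg (by omega), if_neg (fun h => by linarith [h.2])]; ring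
    rw [e1]
    rcases hiM.eq_or_lt with hiM' | hiM'
    · -- `i = M`: the next atom is the product giant; `e = (1−g)u − g ≤ 0 ≤ (u/c)(T − M)`
      subst hiM'
      have e2 : Cp (i + 1) = -1 := by
        rw [hCp (i + 1), if_neg (by omega), if_pos le_rfl, if_neg (by omega)]; ring
      rw [e2]
      have hTM : (i : ℝ) ≤ T := by
        rcases Nat.eq_zero_or_pos i with h0 | hpos
        · subst h0; push_cast; exact hT0
        · have : (1 : ℝ) ≤ i := by exact_mod_cast hpos
          linarith
      linarith [hgu, hR0 (T - i) (sub_nonneg.2 hTM)]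
    · -- `i < M`: the next atom `i + 1 ≤ M` is a mid (compatible or not)
      by_cases hci : T + g < (i : ℝ) + ((i + 1 : ℕ) : ℝ)
      · -- compatible (`c < 1`)
        have e2 : Cp (i + 1) = -(u * (1 / usage y (T + g) M i (i + 1))) := by
          rw [hCp (i + 1), if_neg (by omega), if_neg (by omega), if_pos ⟨by omega, hci⟩]; ring
        rw [e2]
        rcases Nat.eq_zero_or_pos i with h0 | hpos
        · -- `i = 0`, `T + g < 1`: the exact value `e(0) = uT/(T+g)`
          subst h0
          have hTg : 0 < T + g := by linarith
          have hcTg : c = T + g := by rw [hc]; push_cast; ring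
          have hρ : y ≤ (T + g - 2 * ((0 : ℕ) : ℝ)) / (((0 + 1 : ℕ) : ℝ) - ((0 : ℕ) : ℝ)) := by
            have e : (T + g - 2 * ((0 : ℕ) : ℝ)) / (((0 + 1 : ℕ) : ℝ) - ((0 : ℕ) : ℝ)) = T + g := by
              push_cast; ring
            rw [e]; linarith
          have hv : 1 / usage y (T + g) M 0 (0 + 1) = 1 / (T + g) - 1 := by
            rw [one_div_usage_linear y (T + g) M 0 (0 + 1) hy0 (by omega) hρ]; push_cast; ring
          rw [hv, hcTg]
          refine le_div_mul_of_mul_le hTg (le_of_eq ?_)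
          push_cast
          field_simp
          ring
        · -- `i ≥ 1`: drop the (nonpositive) mid term; `(1−g)u ≤ (u/c)(T − i)` since `g(1 − c) ≤ g ≤ 1 ≤ i`
          have hi1 : (1 : ℝ) ≤ i := by exact_mod_cast hpos
          have hcap := hinv0 (i + 1) (by omega) hci
          have h1 : g * -(u * (1 / usage y (T + g) M i (i + 1))) ≤ 0 := by
            have := mul_nonneg hg0.le (mul_nonneg hu0.le hcap)
            linarith
          have h2 : (1 - g) * u ≤ u / c * (T - i) := by
            refine le_div_mul_of_mul_le hc0 ?_
            have h3 : (1 - g) * c ≤ T - i := by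
              have := mul_nonneg hg0.le hc0.le
              have hcT : T - (i : ℝ) = c - g + i := by rw [hc]; ring
              rw [hcT]; linarith
            linarith [mul_le_mul_of_nonneg_left h3 hu0.le]
          linarith
      · -- not compatible (`c ≥ 1`): `e = (1−g)u ≤ (u/c)(T − i)` since `g(1 − c) ≤ 0 ≤ i`
        have e2 : Cp (i + 1) = 0 := by
          rw [hCp (i + 1), if_neg (by omega), if_neg (by omega), if_neg (fun h => hci h.2)]; ring
        rw [e2, mul_zero, add_zero]
        refine le_div_mul_of_mul_le hc0 ?_
        have hc1 : 1 ≤ c := by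
          have hci' := not_lt.1 hci
          push_cast at hci'
          rw [hc]; linarith
        have h3 : (1 - g) * c ≤ T - i := by
          have := mul_le_mul_of_nonneg_left hc1 hg0.le
          have hcT : T - (i : ℝ) = c - g + i := by rw [hc]; ring
          rw [hcT]; linarith
        linarith [mul_le_mul_of_nonneg_left h3 hu0.le]
  ---- `i < a ≤ M`: mids and the top atom
  have hia1 : (i : ℝ) + 1 ≤ a := by exact_mod_cast hia'
  rcases ha.lt_or_eq with haM | haM
  · ---- (C) `i < a < M`: both `a` and `a + 1` are below the product layer
    have e1 : Cp a = -(u * (if a ≤ M ∧ T + g < (i : ℝ) + a then 1 / usage y (T + g) M i a else 0)) := by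
      rw [hCp a, if_neg (by omega), if_neg (by omega)]; ring
    have e2 : Cp (a + 1) = -(u * (if a + 1 ≤ M ∧ T + g < (i : ℝ) + ((a + 1 : ℕ) : ℝ) then
        1 / usage y (T + g) M i (a + 1) else 0)) := by
      rw [hCp (a + 1), if_neg (by omega), if_neg (by omega)]; ring
    rw [e1, e2]
    by_cases haT : (a : ℝ) ≤ T
    · -- below the target: `e ≤ 0 ≤ (u/c)(T − a)`
      have t1 : 0 ≤ (if a ≤ M ∧ T + g < (i : ℝ) + a then 1 / usage y (T + g) M i a else 0) := by
        split_ifs with h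
        · exact hinv0 a h.1 h.2
        · exact le_rfl
      have t2 : 0 ≤ (if a + 1 ≤ M ∧ T + g < (i : ℝ) + ((a + 1 : ℕ) : ℝ) then 1 / usage y (T + g) M i (a + 1) else 0) := by
        split_ifs with h
        · exact hinv0 (a + 1) h.1 h.2
        · exact le_rfl
      linarith [hR0 (T - a) (sub_nonneg.2 haT), mul_nonneg (sub_nonneg.2 hg1) (mul_nonneg hu0.le t1),
        mul_nonneg hg0.le (mul_nonneg hu0.le t2)]
    have haT : T < (a : ℝ) := not_le.1 haT
    by_cases hca : T + g < (i : ℝ) + a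
    · -- `a` compatible (hence `a + 1` and the top `M` too): NOT CHEAP ⟹ linear regime at `a` and `a + 1`
      have hca1 : T + g < (i : ℝ) + ((a + 1 : ℕ) : ℝ) := by push_cast; linarith
      have haM' : (a : ℝ) + 1 ≤ M := by exact_mod_cast haM
      have hcM : T + g < (i : ℝ) + M := by linarith
      have hρM := rho_gt_of_usage_gt y (T + g) M i M hy0 hy1 le_rfl hlow hcM (hu ▸ hnc hcM)
      have hMi : (0 : ℝ) < (M : ℝ) - i := by linarith
      have hyc : y * ((M : ℝ) - i) < c := by rw [hc]; exact (lt_div_iff₀ hMi).1 hρM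
      have hρa : y ≤ (T + g - 2 * (i : ℝ)) / ((a : ℝ) - i) := by
        rw [le_div_iff₀ (by linarith), ← hc]
        have : (a : ℝ) ≤ M := by exact_mod_cast ha
        linarith [mul_le_mul_of_nonneg_left this hy0.le]
      have hρa1 : y ≤ (T + g - 2 * (i : ℝ)) / (((a + 1 : ℕ) : ℝ) - i) := by
        push_cast
        rw [le_div_iff₀ (by linarith), ← hc]
        linarith [mul_le_mul_of_nonneg_left haM' hy0.le]
      rw [if_pos ⟨ha, hca⟩, if_pos ⟨haM, hca1⟩, one_div_usage_linear y (T + g) M i a hy0 ha hρa,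
        one_div_usage_linear y (T + g) M i (a + 1) hy0 haM hρa1, ← hc]
      refine le_div_mul_of_mul_le hc0 ?_
      have key : ((1 - g) * -(u * (((a : ℝ) - i) / c - 1)) + g * -(u * ((((a + 1 : ℕ) : ℝ) - i) / c - 1))) * c
          = -(u * ((a : ℝ) - i + g - c)) := by
        push_cast; field_simp; ring
      rw [key, hc]
      linarith [mul_nonneg hu0.le hi0]
    · -- `a` not compatible but above the target: then `i = 0` and `T < a ≤ T + g`; the shifted copy alone, linear by top-affordability
      have hca' : (i : ℝ) + a ≤ T + g := not_lt.1 hca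
      have hi0' : i = 0 := by
        by_contra hne
        have : (1 : ℝ) ≤ i := by exact_mod_cast Nat.one_le_iff_ne_zero.2 hne
        linarith
      subst hi0'
      push_cast at hca'
      rw [zero_add] at hca'
      have haM' : (a : ℝ) + 1 ≤ M := by exact_mod_cast haM
      have hTg : 0 < T + g := by linarith
      have hcTg : c = T + g := by rw [hc]; push_cast; ring
      have hca1 : T + g < ((0 : ℕ) : ℝ) + ((a + 1 : ℕ) : ℝ) := by push_cast; linarith
      have hρa1 : y ≤ (T + g - 2 * ((0 : ℕ) : ℝ)) / (((a + 1 : ℕ) : ℝ) - ((0 : ℕ) : ℝ)) := by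
        have e : (T + g - 2 * ((0 : ℕ) : ℝ)) / (((a + 1 : ℕ) : ℝ) - ((0 : ℕ) : ℝ)) = (T + g) / ((a : ℝ) + 1) := by
          push_cast; ring
        rw [e, le_div_iff₀ (by linarith)]
        linarith [mul_le_mul_of_nonneg_left haM' hy0.le]
      have hv : 1 / usage y (T + g) M 0 (a + 1) = ((a : ℝ) + 1) / (T + g) - 1 := by
        rw [one_div_usage_linear y (T + g) M 0 (a + 1) hy0 haM hρa1]; push_cast; ring
      rw [if_neg (fun h => hca h.2), if_pos ⟨haM, hca1⟩, hv, hcTg]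
      refine le_div_mul_of_mul_le hTg ?_
      have key : ((1 - g) * -(u * 0) + g * -(u * (((a : ℝ) + 1) / (T + g) - 1))) * (T + g)
          = -(g * u * ((a : ℝ) + 1 - (T + g))) := by
        field_simp; ring
      rw [key]
      linarith [mul_nonneg (mul_nonneg hu0.le (sub_nonneg.2 hg1)) (sub_nonneg.2 hca'), mul_nonneg hg0.le hu0.le]
  · ---- (D) `a = M`, the top atom of the factor (`i < M`): the product giant `M + 1` sits above it
    subst haM
    have e1 : Cp a = -(u * (if a ≤ a ∧ T + g < (i : ℝ) + a then 1 / usage y (T + g) a i a else 0)) := by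
      rw [hCp a, if_neg (by omega), if_neg (by omega)]; ring
    have e2 : Cp (a + 1) = -1 := by
      rw [hCp (a + 1), if_neg (by omega), if_pos le_rfl, if_neg (by omega)]; ring
    rw [e1, e2]
    by_cases haT : (a : ℝ) ≤ T
    · have t1 : 0 ≤ (if a ≤ a ∧ T + g < (i : ℝ) + a then 1 / usage y (T + g) a i a else 0) := by
        split_ifs with h
        · exact hinv0 a h.1 h.2
        · exact le_rfl
      linarith [hR0 (T - a) (sub_nonneg.2 haT), mul_nonneg (sub_nonneg.2 hg1) (mul_nonneg hu0.le t1), hg0]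
    have haT : T < (a : ℝ) := not_le.1 haT
    by_cases hca : T + g < (i : ℝ) + a
    · -- compatible top, NOT CHEAP ⟹ linear
      have hρM := rho_gt_of_usage_gt y (T + g) a i a hy0 hy1 le_rfl hlow hca (hu ▸ hnc hca)
      have hMi : (0 : ℝ) < (a : ℝ) - i := by linarith
      have hyc : y * ((a : ℝ) - i) < c := by rw [hc]; exact (lt_div_iff₀ hMi).1 hρM
      rw [if_pos ⟨le_rfl, hca⟩, one_div_usage_linear y (T + g) a i a hy0 le_rfl hρM.le, ← hc]
      refine le_div_mul_of_mul_le hc0 ?_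
      have key : ((1 - g) * -(u * (((a : ℝ) - i) / c - 1)) + g * -1) * c
          = -((1 - g) * u * ((a : ℝ) - i - c)) - g * c := by
        field_simp; ring
      rw [key]
      -- `u(a − i) < c + c·u`  (from `y(a − i) < c`, dividing by `1 − y`)
      have hyc2 : u * ((a : ℝ) - i) < c + c * u := by
        have e1' : u * ((a : ℝ) - i) * (1 - y) = y * ((a : ℝ) - i) := by rw [hu]; field_simp
        have h := (lt_div_iff₀ h1y).2 (show u * ((a : ℝ) - i) * (1 - y) < c by rw [e1']; exact hyc)
        have e : c / (1 - y) = c + c * u := by rw [hu]; field_simp; ring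
        linarith [h, e]
      have hcT : T - (i : ℝ) = c - g + i := by rw [hc]; ring
      rcases Nat.eq_zero_or_pos i with h0 | hpos
      · -- `i = 0`: top-affordability `u·M ≤ T + u·T` and `(1−g)u ≤ g`
        subst h0
        push_cast at hcT hyc2 ⊢
        have hTA' : u * (a : ℝ) ≤ T + u * T := by
          have e1' : u * (a : ℝ) * (1 - y) = y * a := by rw [hu]; field_simp
          have h := (le_div_iff₀ h1y).2 (show u * (a : ℝ) * (1 - y) ≤ T by rw [e1']; exact hTA)
          have e : T / (1 - y) = T + u * T := by rw [hu]; field_simp; ring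
          linarith [h, e]
        have hX : 0 ≤ c + u * c - u * a - u := by rw [hc]; push_cast; linarith [hTA', hgu]
        have hgX := mul_nonneg hg0.le hX
        linear_combination hgX - u * hcT
      · -- `i ≥ 1`: non-cheapness alone
        have hi1 : (1 : ℝ) ≤ i := by exact_mod_cast hpos
        have h1 := mul_nonneg hu0.le (by linarith : (0 : ℝ) ≤ (i : ℝ) - g)
        have h2 := mul_nonneg hg0.le (by linarith [hyc2] : (0 : ℝ) ≤ c + c * u - u * ((a : ℝ) - i))
        linear_combination h1 + h2 - u * hcT
    · -- top not compatible and above the target: `i = 0`, `T < M ≤ T + g`; `e = −g`, and `u(M − T) ≤ yM ≤ g(T + g)`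
      have hca' : (i : ℝ) + a ≤ T + g := not_lt.1 hca
      have hi0' : i = 0 := by
        by_contra hne
        have : (1 : ℝ) ≤ i := by exact_mod_cast Nat.one_le_iff_ne_zero.2 hne
        linarith
      subst hi0'
      rw [if_neg (fun h => hca h.2)]
      push_cast at hca'
      rw [zero_add] at hca'
      have hTg : 0 < T + g := by linarith
      have hcTg : c = T + g := by rw [hc]; push_cast; ring
      rw [hcTg]
      refine le_div_mul_of_mul_le hTg ?_
      have h2 : u * ((a : ℝ) - T) ≤ y * a := by
        have e1' : u * ((a : ℝ) - T) * (1 - y) = y * ((a : ℝ) - T) := by rw [hu]; field_simp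
        refine le_of_mul_le_mul_right ?_ h1y
        rw [e1']
        linarith [mul_le_mul_of_nonneg_left hTA hy0.le]
      linarith [mul_le_mul_of_nonneg_left hca' hy0.le, mul_le_mul_of_nonneg_right hyg hTg.le, hu0]

/-! ### The row, functional form -/

/-- **THE TILT ROWS OF THE RELAY PRODUCT (functional form).**  `0 < y < 1`, `y ≤ g ≤ 1`; `μ ≥ 0` on `{0..M}` of mass `1` and mean `T`,
top-affordable (`y·M ≤ T`); a product low `i ≤ M` (`2i < T + g`) whose top pair `(i, M)` is NOT cheap at `T + g`
(`T + g < i + M → y/(1−y) < usage y (T+g) M i M`).  Then for `ν = lconv M 1 μ {0: 1−g, 1: g}`: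
`Σ_{h ≤ M+1} C′(h)·ν(h) ≤ 0`, `C′` the coefficient vector of the top-layer `LawDec.TLC` row `(M, i)` at `(y, T + g)` — exactly the hypothesis of
census-2 g67's bridge `tlcRow_of_functional` (`N = M + 1`, `j = M`, `T′ = T + g`), which turns it into the row's body.  These are the rows left out
by the `hcase` hypothesis of `relayConv_tlcRow_of_tlc2` / `relayConv_tlcRowZero_of_tlc`; certificate = the tilt alone (the mean). [this work] -/
theorem relayConv_tlcRowTop_functional (y T g : ℝ) (M i : ℕ) (μ : ℕ → ℝ)
    (hy0 : 0 < y) (hy1 : y < 1) (hyg : y ≤ g) (hg1 : g ≤ 1) (hμ0 : ∀ h, 0 ≤ μ h)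
    (hμ1 : ∑ h ∈ Finset.range (M + 1), μ h = 1) (hμT : ∑ h ∈ Finset.range (M + 1), (h : ℝ) * μ h = T)
    (hTA : y * (M : ℝ) ≤ T) (hiM : i ≤ M) (hlow : 2 * (i : ℝ) < T + g)
    (hnc : T + g < (i : ℝ) + M → y / (1 - y) < usage y (T + g) M i M) :
    ∑ h ∈ Finset.range (M + 1 + 1), (y / (1 - y) * (if h ≤ i then (1 : ℝ) else 0) - (if M + 1 ≤ h then (1 : ℝ) else 0)
      - y / (1 - y) * (if h ≤ M ∧ T + g < (i : ℝ) + h then 1 / usage y (T + g) M i h else 0))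
        * lconv M 1 μ (fun h => if h = 1 then g else if h = 0 then 1 - g else 0) h ≤ 0 := by
  set Cp : ℕ → ℝ := fun h => y / (1 - y) * (if h ≤ i then (1 : ℝ) else 0) - (if M + 1 ≤ h then (1 : ℝ) else 0)
      - y / (1 - y) * (if h ≤ M ∧ T + g < (i : ℝ) + h then 1 / usage y (T + g) M i h else 0) with hCpdef
  have hCp : ∀ h : ℕ, Cp h = y / (1 - y) * (if h ≤ i then (1 : ℝ) else 0) - (if M + 1 ≤ h then (1 : ℝ) else 0)
      - y / (1 - y) * (if h ≤ M ∧ T + g < (i : ℝ) + h then 1 / usage y (T + g) M i h else 0) := fun h => rfl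
  -- the tilt, pointwise
  have key : ∀ a : ℕ, a ≤ M → (1 - g) * Cp a + g * Cp (a + 1) ≤ y / (1 - y) / (T + g - 2 * (i : ℝ)) * (T - a) :=
    fun a ha => relay_tilt_pointwise y T g (y / (1 - y)) (T + g - 2 * (i : ℝ)) i M Cp hy0 hy1 rfl hyg hg1 hiM hlow rfl hTA hnc hCp a ha
  -- integrate against `μ`: the mean pays
  show ∑ h ∈ Finset.range (M + 1 + 1), Cp h * lconv M 1 μ (fun h => if h = 1 then g else if h = 0 then 1 - g else 0) h ≤ 0
  rw [sum_fun_mul_lconv_one]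
  simp only [show ((0 : ℕ) = 1) = False from by simp, if_true, if_false]
  have hsum : ∑ a ∈ Finset.range (M + 1), μ a * (y / (1 - y) / (T + g - 2 * (i : ℝ)) * (T - a))
      = y / (1 - y) / (T + g - 2 * (i : ℝ)) * (T * ∑ a ∈ Finset.range (M + 1), μ a - ∑ a ∈ Finset.range (M + 1), (a : ℝ) * μ a) := by
    rw [Finset.mul_sum, mul_sub, Finset.mul_sum, Finset.mul_sum, ← Finset.sum_sub_distrib]
    exact Finset.sum_congr rfl fun a _ => by ring
  calc ∑ a ∈ Finset.range (M + 1), μ a * ((1 - g) * Cp a + g * Cp (a + 1))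
      ≤ ∑ a ∈ Finset.range (M + 1), μ a * (y / (1 - y) / (T + g - 2 * (i : ℝ)) * (T - a)) :=
        Finset.sum_le_sum fun a ha => mul_le_mul_of_nonneg_left (key a (Nat.lt_succ_iff.1 (Finset.mem_range.1 ha))) (hμ0 a)
    _ = 0 := by rw [hsum, hμ1, hμT]; ring

end LawDec

end Quant

end Summit.CriticalPhenomena.PercolationContinuityZ3.Theorems
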